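import Summits.ResolutionOfSingularities.ResolutionOfSingularities.Theorems.PurelyInseparableDim4AtlasChildChartsFibre
import Summits.ResolutionOfSingularities.ResolutionOfSingularities.Theorems.PurelyInseparableDim4AtlasShapeChartMem
import Summits.ResolutionOfSingularities.ResolutionOfSingularities.Theorems.PurelyInseparableDim4ChartAtlasGlue
import Summits.ResolutionOfSingularities.ResolutionOfSingularities.Theorems.PurelyInseparableDim4ChartZigzagBoundary
import Summits.ResolutionOfSingularities.ResolutionOfSingularities.Theorems.PurelyInseparableDim4JointHereditaryModel
import HarnessLib

/-!
# Purely inseparable four-folds: an ATLAS CHILD at a GENERAL FIBRE POINT is regular, snc with the transformed boundary, and has closed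
# fibre pieces (brick S3 (c) v4, tranche 1, brick A1-admissible′; cell `res-dim4-pi`)

[OURS · counted 0] (D-0157 DOOR 2; host item stmt-ResolutionOfSingularities-16155, helper). Nothing here proves resolution of
singularities in dimension ≥ 4 / characteristic `p`. `…AtlasChildRegularSNC` (p715594) and the fibre-piece theorem of `…AtlasChildPieces`
(p715792) VERBATIM with `b|_S = 0` WEAKENED to `b_m = 0` for the chart indices `m ∈ Pc` (the proofs never used more): the non-escaping
children of atlas parents sit at general points of the exceptional fibre (`b_i`, `i ∈ S ∖ {j}`, arbitrary), memo §9 (I6) / E-V4-1 sequel.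

* `isRegular_and_hasSNCWith_of_chart_readings'`, `isClosed_zigzag_fibre_piece'`. AI-produced formalisation, weaker than expert review.
bears_on: LADDER-RESOLUTION:D157-DOOR2 (res-dim4-pi · S3 (c) v4 A1-admissible′).
-/

set_option linter.dupNamespace false -- D-0017: single-problem summit path `Summit.<S>.<S>.…` by design

noncomputable section

open MvPolynomial Finset CategoryTheory AlgebraicGeometry Opposite TopologicalSpace
open AlgebraicGeometry.Scheme.IdealSheafData (ofIdealTop vanishingIdeal)

namespace Summit.ResolutionOfSingularities.ResolutionOfSingularities.Theorems.PIDim4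

open Literature.AlgebraicGeometry.Resolution
open Literature.AlgebraicGeometry.Resolution.AffinePointBlowup (P A γ coord Wtop ξ)

namespace Equimultiple

section ChildRegularSNC

variable {K : Type} [Field K] {Z Y W Bl : Scheme.{0}} (φ : Y ⟶ Z) [IsOpenImmersion φ] (ψ : Y ⟶ P 4 K) [IsOpenImmersion ψ]
  {π : W ⟶ Z} {B : Bl ⟶ P 4 K} {S : Finset (Fin 4)}
  (ε : (π ⁻¹ᵁ φ.opensRange : Scheme.{0}) ≅ (B ⁻¹ᵁ ψ.opensRange : Scheme.{0}))

/-- **AN ATLAS CHILD IS REGULAR AND SNC WITH THE TRANSFORMED BOUNDARY (general fibre point).** See the module docstring.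
[cite: BierstoneGrigorievMilmanWlodarczyk2011, Def. 3.1.3 (1)–(2)] [cite: Hauser2010, §G] -/
theorem isRegular_and_hasSNCWith_of_chart_readings' [IsLocallyNoetherian Z] (Zc : Z.IdealSheafData) (hπ : IsBlowup π Zc)
    (hB : IsBlowup B (AffineCoordBlowup.𝓘Λ 4 K (insert 0 (Fin.succ '' (S : Set (Fin 4))))))
    (hsq : ε.hom ≫ (B ∣_ ψ.opensRange) = (π ∣_ φ.opensRange) ≫ (φ.isoOpensRange.inv ≫ ψ.isoOpensRange.hom))
    (hC' : ((AffineCoordBlowup.𝓘Λ 4 K (insert 0 (Fin.succ '' (S : Set (Fin 4))))).comap ψ.opensRange.ι).comap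
        (φ.isoOpensRange.inv ≫ ψ.isoOpensRange.hom) = Zc.comap φ.opensRange.ι)
    (M : MarkedIdeal Z) (hsncZ : HasSNCWith M.boundary Zc) (idx : Z.IdealSheafData → Fin 4) (cst : Z.IdealSheafData → K)
    (hshape : ∀ D ∈ M.boundary, ((D.support : Set Z) ∩ φ '' (ψ ⁻¹'
        (AffineCoordBlowup.CΛ 4 K (insert 0 (Fin.succ '' (S : Set (Fin 4)))) : Set (P 4 K)))).Nonempty →
      D.comap φ = (ofIdealTop (Ideal.span {(γ 4 K).symm (X (idx D).succ + C (cst D))})).comap ψ ∧ (idx D ∈ S → cst D = 0))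
    (hinj : ∀ D₁ ∈ M.boundary, ∀ D₂ ∈ M.boundary,
      ((D₁.support : Set Z) ∩ φ '' (ψ ⁻¹' (AffineCoordBlowup.CΛ 4 K (insert 0 (Fin.succ '' (S : Set (Fin 4)))) : Set (P 4 K)))).Nonempty →
      ((D₂.support : Set Z) ∩ φ '' (ψ ⁻¹' (AffineCoordBlowup.CΛ 4 K (insert 0 (Fin.succ '' (S : Set (Fin 4)))) : Set (P 4 K)))).Nonempty →
      idx D₁ = idx D₂ → D₁ = D₂)
    (Pc : Finset (Fin 4)) (hPc : ∀ m ∈ Pc, m ∈ S) (Θ : Fin 4 → (A 4 K ≃ₐ[K] A 4 K)) {b : Fin 4 → K}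
    (hΘ : ∀ m ∈ Pc, ∀ i : Fin 4, Θ m (X i.succ) = X i.succ + C (b i)) (hbP : ∀ m ∈ Pc, b m = 0)
    (Tm : Fin 4 → Finset (Fin 4)) (hTm : ∀ m ∈ Pc, m ∈ Tm m) (c'' : Closeds W)
    (hcov : (c'' : Set W) ⊆ ⋃ (m : Fin 4) (hm : m ∈ Pc),
      Set.range (((Spec.map (CommRingCat.ofHom (Θ m : A 4 K →+* A 4 K)) ≫
          AffineCoordBlowup.chartImm hB (ChartDictionary.succ_mem_centreVars (hPc m hm))) ∣_ (B ⁻¹ᵁ ψ.opensRange)) ≫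
        ε.inv ≫ (π ⁻¹ᵁ φ.opensRange).ι))
    (hread : ∀ (m : Fin 4) (hm : m ∈ Pc),
      (vanishingIdeal c'').comap
          (((Spec.map (CommRingCat.ofHom (Θ m : A 4 K →+* A 4 K)) ≫
              AffineCoordBlowup.chartImm hB (ChartDictionary.succ_mem_centreVars (hPc m hm))) ∣_ (B ⁻¹ᵁ ψ.opensRange)) ≫
            ε.inv ≫ (π ⁻¹ᵁ φ.opensRange).ι) =
        (AffineCoordBlowup.𝓘Λ 4 K (insert 0 (Fin.succ '' (Tm m : Set (Fin 4))))).comap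
          ((Spec.map (CommRingCat.ofHom (Θ m : A 4 K →+* A 4 K)) ≫
              AffineCoordBlowup.chartImm hB (ChartDictionary.succ_mem_centreVars (hPc m hm))) ⁻¹ᵁ (B ⁻¹ᵁ ψ.opensRange)).ι) :
    Scheme.IsRegular (vanishingIdeal c'').subscheme ∧ HasSNCWith (M.transform π Zc).boundary (vanishingIdeal c'') := by
  classical
  haveI : IsProper π := hπ.isProper
  haveI : IsLocallyNoetherian W := LocallyOfFiniteType.isLocallyNoetherian π
  haveI : IsProper B := hB.isProper
  haveI : IsLocallyNoetherian Bl := LocallyOfFiniteType.isLocallyNoetherian B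
  -- the family of zigzag charts of the charts, indexed by `↥Pc`
  let φ₀ : ∀ i : ↥Pc, P 4 K ⟶ Bl := fun i =>
    Spec.map (CommRingCat.ofHom (Θ i.1 : A 4 K →+* A 4 K)) ≫ AffineCoordBlowup.chartImm hB (ChartDictionary.succ_mem_centreVars (hPc i.1 i.2))
  let U : ↥Pc → Scheme.{0} := fun i => ((φ₀ i) ⁻¹ᵁ (B ⁻¹ᵁ ψ.opensRange) : Scheme.{0})
  let φf : ∀ i : ↥Pc, U i ⟶ W := fun i => ((φ₀ i) ∣_ (B ⁻¹ᵁ ψ.opensRange)) ≫ ε.inv ≫ (π ⁻¹ᵁ φ.opensRange).ι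
  let ψf : ∀ i : ↥Pc, U i ⟶ P 4 K := fun i => ((φ₀ i) ⁻¹ᵁ (B ⁻¹ᵁ ψ.opensRange)).ι
  haveI hφ₀ : ∀ i : ↥Pc, IsOpenImmersion (φ₀ i) := fun i => by
    haveI := isOpenImmersion_specMap_algEquiv (Θ i.1)
    change IsOpenImmersion (Spec.map (CommRingCat.ofHom (Θ i.1 : A 4 K →+* A 4 K)) ≫ _)
    infer_instance
  haveI hφf : ∀ i : ↥Pc, IsOpenImmersion (φf i) := fun i => by
    change IsOpenImmersion (((φ₀ i) ∣_ (B ⁻¹ᵁ ψ.opensRange)) ≫ ε.inv ≫ (π ⁻¹ᵁ φ.opensRange).ι)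
    infer_instance
  haveI hψf : ∀ i : ↥Pc, IsOpenImmersion (ψf i) := fun i => by
    change IsOpenImmersion ((φ₀ i) ⁻¹ᵁ (B ⁻¹ᵁ ψ.opensRange)).ι
    infer_instance
  -- the cover of `V(𝓘(c″))` by the family
  have hcov' : (((vanishingIdeal c'').support : Set W)) ⊆ ⋃ i : ↥Pc, Set.range (φf i) := by
    rw [Scheme.IdealSheafData.coe_support_vanishingIdeal]
    intro w hw
    obtain ⟨m, hm, hwm⟩ := Set.mem_iUnion₂.mp (hcov hw)
    exact Set.mem_iUnion.mpr ⟨⟨m, hm⟩, hwm⟩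
  -- the readings, per index
  have hread' : ∀ i : ↥Pc, (vanishingIdeal c'').comap (φf i) =
      (AffineCoordBlowup.𝓘Λ 4 K (insert 0 (Fin.succ '' (Tm i.1 : Set (Fin 4))))).comap (ψf i) := fun i => hread i.1 i.2
  refine ⟨?_, ?_⟩
  · -- regular
    refine ChartDictionary.isRegular_subscheme_of_cover_comap φf hcov' fun i => ?_
    rw [hread' i]
    exact ChartDictionary.isRegular_subscheme_comap_𝓘Λ (ψf i) _
  · -- simple normal crossings with the transformed boundary
    have hE₂ : HasSNC (M.transform π Zc).boundary := MarkedIdeal.hasSNC_transform_boundary M hsncZ hπ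
    refine ChartDictionary.hasSNCWith_of_cover_comap φf hE₂ hcov' fun i => ?_
    obtain ⟨idx₂, cst₂, hshape₂, hinj₂⟩ :=
      shapeT_transform_zigzag_of_chart_mem φ ψ ε Zc hB hsq hC' (hPc i.1 i.2) (hbP i.1 i.2) (hΘ i.1 i.2) (hTm i.1 i.2)
        idx cst hshape hinj
    have hEc₂ := ChartDictionary.hasSNCWith_comap_of_shapeT_zigzag (φf i) (ψf i) hE₂ idx₂ cst₂ hshape₂ hinj₂
    rw [hread' i]
    exact hEc₂

/-- **THE FIBRE PIECES OF AN ATLAS CHILD ARE CLOSED (general fibre point).** Setting of `atlas_child_of_charts'`; in addition the re-centrings are cleanings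
(`Θ_m z = z + h_m(x)`), `S ∖ {m} ⊆ T_m ∪ (Pc ∖ {m})` and `(Pc ∖ {m}) ∩ T_m = ∅`. Then for every `m ∈ Pc` and `v` the zigzag image of
`V(z, x_{T_m}) ∩ {x_i = v_i : i ∈ Pc ∖ {m}}` is closed in `W`. [cite: BierstoneGrigorievMilmanWlodarczyk2011, Def. 3.1.3 (2)]
[cite: StacksProject, Tag 01J7] -/
theorem isClosed_zigzag_fibre_piece'
    (hB : IsBlowup B (AffineCoordBlowup.𝓘Λ 4 K (insert 0 (Fin.succ '' (S : Set (Fin 4))))))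
    (hsq : ε.hom ≫ (B ∣_ ψ.opensRange) = (π ∣_ φ.opensRange) ≫ (φ.isoOpensRange.inv ≫ ψ.isoOpensRange.hom))
    (Pc : Finset (Fin 4)) (hPc : ∀ m ∈ Pc, m ∈ S) (Θ : Fin 4 → (A 4 K ≃ₐ[K] A 4 K)) {b : Fin 4 → K}
    (hΘ : ∀ m ∈ Pc, ∀ i : Fin 4, Θ m (X i.succ) = X i.succ + C (b i)) (hbP : ∀ m ∈ Pc, b m = 0)
    (hΘ0 : ∀ m ∈ Pc, ∃ h : MvPolynomial (Fin 4) K, Θ m (X 0) = X 0 + rename Fin.succ h)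
    (Tm : Fin 4 → Finset (Fin 4)) (hTm : ∀ m ∈ Pc, m ∈ Tm m) (hST : ∀ m ∈ Pc, S.erase m ⊆ Tm m ∪ Pc.erase m)
    (hPT : ∀ m ∈ Pc, ∀ i ∈ Pc, i ≠ m → i ∉ Tm m)
    (D : Finset (Fin 4)) (hD : ∀ i ∈ D, i ∉ S ∧ ∀ m ∈ Pc, i ∈ Tm m)
    (hfib : IsClosed (φ '' (ψ ⁻¹' {x : P 4 K | x ∈ (AffineCoordBlowup.CΛ 4 K (insert 0 (Fin.succ '' (S : Set (Fin 4)))) : Set (P 4 K)) ∧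
      ∀ i ∈ D, (X i.succ - C (b i) : A 4 K) ∈ x.asIdeal})))
    (Zm : Bl.IdealSheafData)
    (hZread : ∀ m (hm : m ∈ Pc), Zm.comap (Spec.map (CommRingCat.ofHom (Θ m : A 4 K →+* A 4 K)) ≫
        AffineCoordBlowup.chartImm hB (ChartDictionary.succ_mem_centreVars (hPc m hm))) =
      AffineCoordBlowup.𝓘Λ 4 K (insert 0 (Fin.succ '' (Tm m : Set (Fin 4)))))
    (hcov : (Zm.support : Set Bl) ⊆ ⋃ (m : Fin 4) (hm : m ∈ Pc),
      Set.range (Spec.map (CommRingCat.ofHom (Θ m : A 4 K →+* A 4 K)) ≫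
        AffineCoordBlowup.chartImm hB (ChartDictionary.succ_mem_centreVars (hPc m hm))))
    {m : Fin 4} (hm : m ∈ Pc) (v : Fin 4 → K) :
    IsClosed ((((Spec.map (CommRingCat.ofHom (Θ m : A 4 K →+* A 4 K)) ≫
            AffineCoordBlowup.chartImm hB (ChartDictionary.succ_mem_centreVars (hPc m hm))) ∣_ (B ⁻¹ᵁ ψ.opensRange)) ≫
          ε.inv ≫ (π ⁻¹ᵁ φ.opensRange).ι) ''
        (((Spec.map (CommRingCat.ofHom (Θ m : A 4 K →+* A 4 K)) ≫
            AffineCoordBlowup.chartImm hB (ChartDictionary.succ_mem_centreVars (hPc m hm))) ⁻¹ᵁ (B ⁻¹ᵁ ψ.opensRange)).ι ⁻¹'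
          ((AffineCoordBlowup.CΛ 4 K (insert 0 (Fin.succ '' (Tm m : Set (Fin 4)))) : Set (P 4 K)) ∩
            {y : P 4 K | ∀ i ∈ Pc.erase m, (X i.succ - C (v i) : A 4 K) ∈ y.asIdeal}))) := by
  classical
  -- the chart points of the model centre lie in `V(z, x_{T_m})`
  have hread' : ∀ m (hm : m ∈ Pc), (Zm.support : Set Bl) ∩
      Set.range (Spec.map (CommRingCat.ofHom (Θ m : A 4 K →+* A 4 K)) ≫
        AffineCoordBlowup.chartImm hB (ChartDictionary.succ_mem_centreVars (hPc m hm))) ⊆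
      (Spec.map (CommRingCat.ofHom (Θ m : A 4 K →+* A 4 K)) ≫
        AffineCoordBlowup.chartImm hB (ChartDictionary.succ_mem_centreVars (hPc m hm))) ''
        (AffineCoordBlowup.CΛ 4 K (insert 0 (Fin.succ '' (Tm m : Set (Fin 4)))) : Set (P 4 K)) := by
    rintro m hm z ⟨hz, y, rfl⟩
    refine ⟨y, ?_, rfl⟩
    have h1 : y ∈ (Zm.comap (Spec.map (CommRingCat.ofHom (Θ m : A 4 K →+* A 4 K)) ≫
        AffineCoordBlowup.chartImm hB (ChartDictionary.succ_mem_centreVars (hPc m hm)))).support := by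
      rw [Scheme.IdealSheafData.support_comap]; exact hz
    rw [hZread m hm, AffineCoordBlowup.support_𝓘Λ] at h1
    exact h1
  -- the fibre piece as a translated coordinate subspace `V(z, x_i − c_i : i ∈ T_m ∪ (Pc ∖ {m}))`
  set c : Fin 4 → K := fun i => if i ∈ Tm m then 0 else v i with hc
  have hcm : c m = 0 := by simp only [hc, if_pos (hTm m hm)]
  have hset : ((AffineCoordBlowup.CΛ 4 K (insert 0 (Fin.succ '' (Tm m : Set (Fin 4)))) : Set (P 4 K)) ∩
      {y : P 4 K | ∀ i ∈ Pc.erase m, (X i.succ - C (v i) : A 4 K) ∈ y.asIdeal}) =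
      {x : P 4 K | (X 0 : A 4 K) ∈ x.asIdeal ∧ ∀ i ∈ Tm m ∪ Pc.erase m, (X i.succ - C (c i) : A 4 K) ∈ x.asIdeal} := by
    ext y
    simp only [Set.mem_inter_iff, Set.mem_setOf_eq, SetLike.mem_coe, AffineCoordBlowup.mem_CΛ_iff', Finset.mem_union,
      Set.mem_insert_iff, Set.mem_image]
    constructor
    · rintro ⟨h1, h2⟩
      refine ⟨h1 0 (Or.inl rfl), fun i hi => ?_⟩
      rcases hi with hi | hi
      · rw [hc]; simp only [if_pos hi, C_0, sub_zero]
        exact h1 i.succ (Or.inr ⟨i, hi, rfl⟩)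
      · have hiT : i ∉ Tm m := hPT m hm i (Finset.mem_of_mem_erase hi) (Finset.ne_of_mem_erase hi)
        rw [hc]; simp only [if_neg hiT]
        exact h2 i hi
    · rintro ⟨h0, h2⟩
      refine ⟨?_, fun i hi => ?_⟩
      · rintro k (rfl | ⟨i, hi, rfl⟩)
        · exact h0
        · have := h2 i (Or.inl hi)
          rw [hc] at this; simpa only [if_pos hi, C_0, sub_zero] using this
      · have hiT : i ∉ Tm m := hPT m hm i (Finset.mem_of_mem_erase hi) (Finset.ne_of_mem_erase hi)
        have := h2 i (Or.inr hi)
        rw [hc] at this; simpa only [if_neg hiT] using this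
  -- closed on the model (61a), then transported over the parent's closed base
  obtain ⟨h, h0⟩ := hΘ0 m hm
  have hTc : IsClosed ((Spec.map (CommRingCat.ofHom (Θ m : A 4 K →+* A 4 K)) ≫
        AffineCoordBlowup.chartImm hB (ChartDictionary.succ_mem_centreVars (hPc m hm))) ''
      (((AffineCoordBlowup.CΛ 4 K (insert 0 (Fin.succ '' (Tm m : Set (Fin 4)))) : Set (P 4 K)) ∩
        {y : P 4 K | ∀ i ∈ Pc.erase m, (X i.succ - C (v i) : A 4 K) ∈ y.asIdeal}))) := by
    rw [hset]
    exact isClosed_image_waitingSetZ_chart hB (hPc m hm) (hbP m hm) h0 (hΘ m hm) hcm (hST m hm)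
  refine ChartDictionary.zigzag_transport_isClosed φ ψ ε _ hsq _ _ hTc hfib fun y hy => ?_
  have hz : (Spec.map (CommRingCat.ofHom (Θ m : A 4 K →+* A 4 K)) ≫
      AffineCoordBlowup.chartImm hB (ChartDictionary.succ_mem_centreVars (hPc m hm))) y ∈ (Zm.support : Set Bl) := by
    have h1 : y ∈ ((Zm.comap (Spec.map (CommRingCat.ofHom (Θ m : A 4 K →+* A 4 K)) ≫
        AffineCoordBlowup.chartImm hB (ChartDictionary.succ_mem_centreVars (hPc m hm)))).support : Set (P 4 K)) := by
      rw [hZread m hm, AffineCoordBlowup.support_𝓘Λ]; exact hy.1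
    rw [Scheme.IdealSheafData.support_comap] at h1
    exact h1
  exact apply_mem_base_of_cover_readings' hB Pc hPc Θ hΘ hbP Tm hTm D hD (Zm.support : Set Bl) hcov hread' hz

end ChildRegularSNC

end Equimultiple

end Summit.ResolutionOfSingularities.ResolutionOfSingularities.Theorems.PIDim4

end
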